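import Summits.ValiantsHypothesis.ValiantsHypothesis.Theorems.BarrierLeverAnchoredDoorHitsLowerPairsDecrementFamily
import Summits.ValiantsHypothesis.ValiantsHypothesis.Theorems.BarrierLeverAnchoredDoorHitsLowerPairsLTKey
import Mathlib.Combinatorics.Colex

/-!
# Support item `AnchoredDoorHitsLowerPairs` (stmt-ValiantsHypothesis-22510), line `anchored-peeling`:
# THE DECREMENT CERTIFICATE FOR GENERAL `k` — DEFINITIONS (doors, rows, column descriptors, designated rows, owner map, key)

Helper file (`--supports stmt-ValiantsHypothesis-22510`; cell valiant-natproofs, rung V4, 𝒟-side door (c); registered line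
`Cruxes/AnchoredDoorHitsLowerPairs/Lines/anchored_peeling.lean` v20, registered stub `Stmt.stub_decrementFamily` (CONJECTURE DC, `…DecrementFamily`,
p650456); prover seat val-np-p1 gen 23; memo HOME/val-np-p1/g22/MEMO-relapex-valnp1-g22.md §12–§15 = the paper proof being formalised). Closes NO item.

WHAT. The data of the kernel proof of CONJECTURE DC for every `k ≥ 1` (the canonical residual pair `(R_{k+1}, K_{2^{k+1}−1})` — rows `DecRow k h`,
columns `DecCol k h` — is hit at profile 1), in the shape consumed by `symbolicDet_one_ne_zero_of_key` (`…LTKey`, p650999):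
* index sets are `Finset ℕ` (subsets of `range k`), with binary value `enc`, bit set `bits`, tag bit `rho` (= the TOP set bit; the memo's lowest bit is
  not needed — any set bit works);
* `rowOf k S e T` = the row face `a_S ∪ eα ∪ b_T` (`a_i` = variable `i < k`, `α` = variable `k`, `b_j` = variable `k+1+j`) and its decoding `aIdx/eBit/bIdx`;
* the 0/1 DECREMENT DOORS `roots k`, `tails k` (vertex number `c = v.val + 1`: `γ_P` for `c = P < 2^k`, `ω` for `c = 2^k`, `δ_Q` for `c = 2^k + Q`):
  `ω = x_α`; `γ_P = x_{a_ρ(P)} ∏_{i ∈ P∖ρ} (1 + x_{a_i}) + x_α ∏_{i∈P} (1 + x_{b_i})`; `δ_Q = x_{b_ρ(Q)} ∏_{i∈Q∖ρ} (1 + x_{b_i}) + x_α ∏_{i ∈ Q−1} (1 + x_{a_i})`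
  (binary decrement);
* the nine column types `Col` with validity, vertex numbers `Col.verts`, the column finset `colOf`, the DESIGNATED TRIPLE `Col.dtrip` (memo §15: `∅→(0,0,0)`,
  `ω→(0,1,0)`, `γ_P→(P,0,0)`, `δ_Q→(0,0,Q)`, `γ_Pδ_Q→(P,0,Q)`, `ωγ_P→(P,1,0)`, `ωδ_Q→(0,1,Q)`, `γ_Pγ_P'→(P,1,P')`, `δ_Qδ_Q'→(Q'−1,1,Q)`), the OWNER map
  `own` (its inverse on rows) and the KEY `Col.key` — a 4-component lexicographic key packed into one natural by `tk`
  (`∅ (0) < ω (1) < ω-edges (2,side,P) < vertices (3,side,P) < crosses (4,P,Q) < E-columns (5, P, 2|P'|+1, P') / (5, Q, 2|Q'−1|, Q')`; simplification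
  vs the memo: no popcount is needed in the class-0 keys).
Basic API only (membership, coding/decoding, key arithmetic). The support analysis, the bijection and the assembly are in the sequel files
`…DecrementGeneralBlocks/Owner/Support/`, `…DecrementGeneral`. Lab validation of exactly this data for `k ≤ 7` (`r ≤ 32 641`): folder lab/dccheck.py.

WHAT THIS IS NOT: no theorem about the item here; nothing on crux stmt-ValiantsHypothesis-14610 or on `VP` versus `VNP`.
-/

set_option linter.dupNamespace false

namespace Summit.ValiantsHypothesis.ValiantsHypothesis.Theorems.BarrierLever.AnchoredPeeling

namespace DecFamily

open Finset

variable {h : ℕ}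

/-! ## 1. Index sets: binary value, bit set, tag bit -/

/-- Binary value of an index set: `enc S = ∑_{i∈S} 2^i`. -/
def enc (S : Finset ℕ) : ℕ := ∑ i ∈ S, 2 ^ i

/-- The index set (set bits) of a natural number. -/
def bits (n : ℕ) : Finset ℕ := n.bitIndices.toFinset

/-- The tag bit of a number: its top set bit (`Nat.log2`); for `n ≠ 0` it is a member of `bits n`. -/
def rho (n : ℕ) : ℕ := Nat.log2 n

/-- Membership in `bits`. -/
theorem mem_bits {n i : ℕ} : i ∈ bits n ↔ n.testBit i = true := by
  simp [bits]

/-- `bits ∘ enc = id`. -/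
theorem bits_enc (S : Finset ℕ) : bits (enc S) = S := Finset.toFinset_bitIndices_sum_two_pow S

/-- `enc ∘ bits = id`. -/
theorem enc_bits (n : ℕ) : enc (bits n) = n := Finset.sum_toFinset_bitIndices_two_pow n

/-- `enc` is injective. -/
theorem enc_injective : Function.Injective enc := Finset.geomSum_injective (le_refl 2)

/-- The bits of a number `< 2^k` are `< k`. -/
theorem bits_subset_range {n k : ℕ} (hn : n < 2 ^ k) : bits n ⊆ range k := by
  intro i hi
  rw [mem_bits] at hi
  rw [mem_range]
  by_contra hik
  have : n.testBit i = false := Nat.testBit_lt_two_pow (lt_of_lt_of_le hn (Nat.pow_le_pow_right (by norm_num) (not_lt.mp hik)))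
  rw [this] at hi
  exact Bool.false_ne_true hi

/-- An index set inside `range k` has value `< 2^k`. -/
theorem enc_lt_two_pow {S : Finset ℕ} {k : ℕ} (hS : S ⊆ range k) : enc S < 2 ^ k :=
  Nat.geomSum_lt (le_refl 2) (fun _ hi => mem_range.mp (hS hi))

/-- `enc` is monotone for inclusion. -/
theorem enc_le_enc_of_subset {S T : Finset ℕ} (hST : S ⊆ T) : enc S ≤ enc T :=
  Finset.sum_le_sum_of_subset hST

/-- `enc` is strictly monotone for strict inclusion. -/
theorem enc_lt_enc_of_ssubset {S T : Finset ℕ} (hST : S ⊂ T) : enc S < enc T :=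
  lt_of_le_of_ne (enc_le_enc_of_subset hST.subset) (fun heq => hST.ne (enc_injective heq))

/-- `enc S = 0 ↔ S = ∅`. -/
theorem enc_eq_zero_iff {S : Finset ℕ} : enc S = 0 ↔ S = ∅ := by
  constructor
  · intro h0
    have : bits (enc S) = bits 0 := by rw [h0]
    rw [bits_enc] at this
    rw [this]
    simp [bits]
  · rintro rfl
    simp [enc]

/-- `bits n = ∅ ↔ n = 0`. -/
theorem bits_eq_empty_iff {n : ℕ} : bits n = ∅ ↔ n = 0 := by
  rw [← enc_eq_zero_iff, enc_bits]

/-- The tag bit of a nonzero number is one of its bits. -/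
theorem rho_mem_bits {n : ℕ} (hn : n ≠ 0) : rho n ∈ bits n := mem_bits.mpr (Nat.testBit_log2 hn)

/-- The tag bit of a number `0 < n < 2^k` is `< k`. -/
theorem rho_lt {n k : ℕ} (hn : n ≠ 0) (hnk : n < 2 ^ k) : rho n < k := (Nat.log2_lt hn).mpr hnk

/-! ## 2. A four-component lexicographic key packed into one natural number -/

/-- `tk R t a b c = ((t·R + a)·R + b)·R + c` — lexicographic on `(t,a,b,c)` when `a,b,c < R`. -/
def tk (R t a b c : ℕ) : ℕ := ((t * R + a) * R + b) * R + c

/-- One lexicographic step. -/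
theorem mul_add_lt_mul_add_of_lt {R x x' y y' : ℕ} (hx : x < x') (hy : y < R) : x * R + y < x' * R + y' :=
  calc x * R + y < x * R + R := by omega
    _ = (x + 1) * R := by ring
    _ ≤ x' * R := Nat.mul_le_mul_right R hx
    _ ≤ x' * R + y' := Nat.le_add_right _ _

/-- One lexicographic step, injectivity. -/
theorem mul_add_eq_mul_add_iff {R x x' y y' : ℕ} (hy : y < R) (hy' : y' < R) : x * R + y = x' * R + y' ↔ x = x' ∧ y = y' := by
  constructor
  · intro heq
    rcases lt_trichotomy x x' with hlt | rfl | hgt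
    · exact absurd heq (ne_of_lt (mul_add_lt_mul_add_of_lt hlt hy))
    · exact ⟨rfl, by omega⟩
    · exact absurd heq.symm (ne_of_lt (mul_add_lt_mul_add_of_lt hgt hy'))
  · rintro ⟨rfl, rfl⟩; rfl

/-- **`tk` is lexicographic.** -/
theorem tk_lt_tk {R t a b c t' a' b' c' : ℕ} (ha : a < R) (hb : b < R) (hc : c < R) (hb' : b' < R)
    (hlex : t < t' ∨ (t = t' ∧ (a < a' ∨ (a = a' ∧ (b < b' ∨ (b = b' ∧ c < c')))))) : tk R t a b c < tk R t' a' b' c' := by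
  unfold tk
  rcases hlex with ht | ⟨rfl, ha2 | ⟨rfl, hb2 | ⟨rfl, hc2⟩⟩⟩
  · exact mul_add_lt_mul_add_of_lt (mul_add_lt_mul_add_of_lt (mul_add_lt_mul_add_of_lt ht ha) hb) hc
  · exact mul_add_lt_mul_add_of_lt (mul_add_lt_mul_add_of_lt (by omega) hb) hc
  · exact mul_add_lt_mul_add_of_lt (by omega) hc
  · omega

/-- **`tk` is injective on bounded components.** -/
theorem tk_inj {R t a b c t' a' b' c' : ℕ} (ha : a < R) (hb : b < R) (hc : c < R) (ha' : a' < R) (hb' : b' < R) (hc' : c' < R)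
    (heq : tk R t a b c = tk R t' a' b' c') : t = t' ∧ a = a' ∧ b = b' ∧ c = c' := by
  unfold tk at heq
  obtain ⟨h1, rfl⟩ := (mul_add_eq_mul_add_iff hc hc').mp heq
  obtain ⟨h2, rfl⟩ := (mul_add_eq_mul_add_iff hb hb').mp h1
  obtain ⟨rfl, rfl⟩ := (mul_add_eq_mul_add_iff ha ha').mp h2
  exact ⟨rfl, rfl, rfl, rfl⟩

/-! ## 3. Rows: the face `a_S ∪ eα ∪ b_T` and its decoding -/

/-- The row face with `a`-index set `S` (variables `i`, `i ∈ S`, `i < k`), `α`-bit `e` (variable `k`) and `b`-index set `T` (variables `k+1+j`, `j ∈ T`). -/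
def rowOf (k : ℕ) (S : Finset ℕ) (e : Bool) (T : Finset ℕ) : Finset (Fin h) :=
  univ.filter fun x => (x.val < k ∧ x.val ∈ S) ∨ (x.val = k ∧ e = true) ∨ (k < x.val ∧ x.val - (k + 1) ∈ T)

/-- Membership in `rowOf`. -/
theorem mem_rowOf {k : ℕ} {S T : Finset ℕ} {e : Bool} {x : Fin h} :
    x ∈ rowOf k S e T ↔ (x.val < k ∧ x.val ∈ S) ∨ (x.val = k ∧ e = true) ∨ (k < x.val ∧ x.val - (k + 1) ∈ T) := by
  simp [rowOf]

/-- The `a`-index set of a face: values `< k` occurring in it. -/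
def aIdx (k : ℕ) (U : Finset (Fin h)) : Finset ℕ := (U.image Fin.val).filter (· < k)

/-- The `α`-bit of a face: whether the variable `k` occurs. -/
def eBit (k : ℕ) (U : Finset (Fin h)) : Bool := decide (k ∈ U.image Fin.val)

/-- The `b`-index set of a face: `j` such that the variable `k+1+j` occurs. -/
def bIdx (k : ℕ) (U : Finset (Fin h)) : Finset ℕ := (U.filter fun x => k < x.val).image fun x => x.val - (k + 1)

/-- Membership in `aIdx`. -/
theorem mem_aIdx {k : ℕ} {U : Finset (Fin h)} {i : ℕ} : i ∈ aIdx k U ↔ i < k ∧ ∃ x ∈ U, x.val = i := by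
  simp only [aIdx, mem_filter, mem_image]
  tauto

/-- Value of `eBit`. -/
theorem eBit_eq_true_iff {k : ℕ} {U : Finset (Fin h)} : eBit k U = true ↔ ∃ x ∈ U, x.val = k := by
  simp [eBit]

/-- Membership in `bIdx`. -/
theorem mem_bIdx {k : ℕ} {U : Finset (Fin h)} {j : ℕ} : j ∈ bIdx k U ↔ ∃ x ∈ U, x.val = k + 1 + j := by
  simp only [bIdx, mem_image, mem_filter]
  constructor
  · rintro ⟨x, ⟨hxU, hkx⟩, hj⟩
    exact ⟨x, hxU, by omega⟩
  · rintro ⟨x, hxU, hx⟩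
    exact ⟨x, ⟨hxU, by omega⟩, by omega⟩

/-- Decoding a `rowOf` (in a large enough ambient `Fin h`): the `a`-index set. -/
theorem aIdx_rowOf {k : ℕ} {S T : Finset ℕ} {e : Bool} (hS : S ⊆ range k) (hk : 2 * k + 1 ≤ h) :
    aIdx k (rowOf (h := h) k S e T) = S := by
  ext i
  rw [mem_aIdx]
  constructor
  · rintro ⟨hik, x, hx, rfl⟩
    rcases mem_rowOf.mp hx with ⟨_, h1⟩ | ⟨h2, _⟩ | ⟨h3, _⟩
    · exact h1
    · omega
    · omega
  · intro hi
    have hik : i < k := mem_range.mp (hS hi)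
    exact ⟨hik, ⟨i, by omega⟩, mem_rowOf.mpr (Or.inl ⟨hik, hi⟩), rfl⟩

/-- Decoding a `rowOf`: the `α`-bit. -/
theorem eBit_rowOf {k : ℕ} {S T : Finset ℕ} {e : Bool} (hk : 2 * k + 1 ≤ h) :
    eBit k (rowOf (h := h) k S e T) = e := by
  rcases Bool.eq_false_or_eq_true e with rfl | rfl
  · rw [eBit_eq_true_iff]
    exact ⟨⟨k, by omega⟩, mem_rowOf.mpr (Or.inr (Or.inl ⟨rfl, rfl⟩)), rfl⟩
  · rw [Bool.eq_false_iff, ne_eq, eBit_eq_true_iff]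
    rintro ⟨x, hx, hxk⟩
    rcases mem_rowOf.mp hx with ⟨h1, _⟩ | ⟨_, h2⟩ | ⟨h3, _⟩
    · omega
    · exact Bool.false_ne_true h2
    · omega

/-- Decoding a `rowOf`: the `b`-index set. -/
theorem bIdx_rowOf {k : ℕ} {S T : Finset ℕ} {e : Bool} (hT : T ⊆ range k) (hk : 2 * k + 1 ≤ h) :
    bIdx k (rowOf (h := h) k S e T) = T := by
  ext j
  rw [mem_bIdx]
  constructor
  · rintro ⟨x, hx, hxj⟩
    rcases mem_rowOf.mp hx with ⟨h1, _⟩ | ⟨h2, _⟩ | ⟨_, h3⟩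
    · omega
    · omega
    · have : x.val - (k + 1) = j := by omega
      rw [this] at h3; exact h3
  · intro hj
    have hjk : j < k := mem_range.mp (hT hj)
    refine ⟨⟨k + 1 + j, by omega⟩, mem_rowOf.mpr (Or.inr (Or.inr ⟨by simp only []; omega, ?_⟩)), rfl⟩
    have : k + 1 + j - (k + 1) = j := by omega
    simp only [this]; exact hj

/-- Every face is the `rowOf` of its decoding. -/
theorem rowOf_decode (k : ℕ) (U : Finset (Fin h)) : rowOf k (aIdx k U) (eBit k U) (bIdx k U) = U := by
  ext x
  rw [mem_rowOf, mem_aIdx, eBit_eq_true_iff, mem_bIdx]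
  constructor
  · rintro (⟨_, _, y, hy, hyx⟩ | ⟨hxk, y, hy, hyk⟩ | ⟨hkx, y, hy, hyx⟩)
    · rw [← Fin.ext hyx]; exact hy
    · have : y = x := Fin.ext (by omega)
      rw [← this]; exact hy
    · have : y = x := Fin.ext (by omega)
      rw [← this]; exact hy
  · intro hx
    rcases lt_trichotomy x.val k with hlt | heq | hgt
    · exact Or.inl ⟨hlt, hlt, x, hx, rfl⟩
    · exact Or.inr (Or.inl ⟨heq, x, hx, heq⟩)
    · exact Or.inr (Or.inr ⟨hgt, x, hx, by omega⟩)

/-- The decoded index sets of a face on the variables `≤ 2k` lie in `range k`. -/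
theorem aIdx_subset_range (k : ℕ) (U : Finset (Fin h)) : aIdx k U ⊆ range k := fun _ hi => mem_range.mpr (mem_aIdx.mp hi).1

/-- The decoded `b`-index set of a face on the variables `≤ 2k` lies in `range k`. -/
theorem bIdx_subset_range {k : ℕ} {U : Finset (Fin h)} (hU : ∀ x ∈ U, x.val ≤ 2 * k) : bIdx k U ⊆ range k := by
  intro j hj
  obtain ⟨x, hx, hxj⟩ := mem_bIdx.mp hj
  have := hU x hx
  rw [mem_range]; omega

/-! ## 4. The decrement doors (0/1 supports): roots and tails per vertex -/

/-- Root set of the vertex `v` (vertex number `c = v.val + 1`): `γ_P` (`c = P < 2^k`): `{a_{ρ(P)}, α}`; `ω` (`c = 2^k`): `{α}`;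
`δ_Q` (`c = 2^k + Q`): `{b_{ρ(Q)}, α}`. -/
def roots (k : ℕ) (v : Fin h) : Finset (Fin h) := univ.filter fun x =>
  x.val = k ∨ (v.val + 1 < 2 ^ k ∧ x.val = rho (v.val + 1)) ∨ (2 ^ k < v.val + 1 ∧ x.val = k + 1 + rho (v.val + 1 - 2 ^ k))

/-- Tail set of the vertex `v` at the root `b`: `γ_P`: at `a_ρ` the other `a_i`, `i ∈ P`; at `α` the `b_i`, `i ∈ P`. `δ_Q`: at `b_ρ` the other `b_i`, `i ∈ Q`;
at `α` the `a_i`, `i ∈ Q − 1` (binary decrement). `ω`: none. -/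
def tails (k : ℕ) (v b : Fin h) : Finset (Fin h) := univ.filter fun x =>
  (v.val + 1 < 2 ^ k ∧
    ((b.val = rho (v.val + 1) ∧ x.val < k ∧ x.val ∈ bits (v.val + 1) ∧ x.val ≠ rho (v.val + 1)) ∨
     (b.val = k ∧ k < x.val ∧ x.val - (k + 1) ∈ bits (v.val + 1)))) ∨
  (2 ^ k < v.val + 1 ∧
    ((b.val = k + 1 + rho (v.val + 1 - 2 ^ k) ∧ k < x.val ∧ x.val - (k + 1) ∈ bits (v.val + 1 - 2 ^ k) ∧ x.val ≠ b.val) ∨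
     (b.val = k ∧ x.val < k ∧ x.val ∈ bits (v.val + 1 - 2 ^ k - 1))))

/-- Membership in `roots`. -/
theorem mem_roots {k : ℕ} {v x : Fin h} : x ∈ roots k v ↔
    x.val = k ∨ (v.val + 1 < 2 ^ k ∧ x.val = rho (v.val + 1)) ∨ (2 ^ k < v.val + 1 ∧ x.val = k + 1 + rho (v.val + 1 - 2 ^ k)) := by
  simp [roots]

/-- Membership in `tails`. -/
theorem mem_tails {k : ℕ} {v b x : Fin h} : x ∈ tails k v b ↔
    (v.val + 1 < 2 ^ k ∧
      ((b.val = rho (v.val + 1) ∧ x.val < k ∧ x.val ∈ bits (v.val + 1) ∧ x.val ≠ rho (v.val + 1)) ∨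
       (b.val = k ∧ k < x.val ∧ x.val - (k + 1) ∈ bits (v.val + 1)))) ∨
    (2 ^ k < v.val + 1 ∧
      ((b.val = k + 1 + rho (v.val + 1 - 2 ^ k) ∧ k < x.val ∧ x.val - (k + 1) ∈ bits (v.val + 1 - 2 ^ k) ∧ x.val ≠ b.val) ∨
       (b.val = k ∧ x.val < k ∧ x.val ∈ bits (v.val + 1 - 2 ^ k - 1)))) := by
  simp [tails]

/-- `IsBlock B T v X`: `X` is one block of the vertex `v` for the support data `(B, T)` — a root `b ∈ B v` together with a subset of its tail set. -/
def IsBlock (B : Fin h → Finset (Fin h)) (T : Fin h → Fin h → Finset (Fin h)) (v : Fin h) (X : Finset (Fin h)) : Prop :=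
  ∃ b ∈ B v, b ∈ X ∧ X ⊆ insert b (T v b)

/-! ## 5. The nine column types: descriptors, validity, vertex numbers, column finset, designated triple, owner, key -/

/-- Column descriptors of the complete graph on `γ_P` (`P`), `ω`, `δ_Q` (`Q`), `1 ≤ P, Q < 2^k`, as a one-dimensional complex (faces of size `≤ 2`). -/
inductive Col : Type
  /-- the empty column -/
  | empty : Col
  /-- the vertex `ω` -/
  | om : Col
  /-- the vertex `γ_P` -/
  | gam (P : ℕ) : Col
  /-- the vertex `δ_Q` -/
  | del (Q : ℕ) : Col
  /-- the edge `ω γ_P` -/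
  | omGam (P : ℕ) : Col
  /-- the edge `ω δ_Q` -/
  | omDel (Q : ℕ) : Col
  /-- the cross edge `γ_P δ_Q` -/
  | cross (P Q : ℕ) : Col
  /-- the edge `γ_P γ_P'`, `P < P'` -/
  | gg (P P' : ℕ) : Col
  /-- the edge `δ_Q δ_Q'`, `Q < Q'` -/
  | dd (Q Q' : ℕ) : Col

/-- Validity of a descriptor at level `k`: indices in `[1, 2^k)`, edge indices increasing. -/
def Col.Valid (k : ℕ) : Col → Prop
  | .empty => True
  | .om => True
  | .gam P => 1 ≤ P ∧ P < 2 ^ k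
  | .del Q => 1 ≤ Q ∧ Q < 2 ^ k
  | .omGam P => 1 ≤ P ∧ P < 2 ^ k
  | .omDel Q => 1 ≤ Q ∧ Q < 2 ^ k
  | .cross P Q => 1 ≤ P ∧ P < 2 ^ k ∧ 1 ≤ Q ∧ Q < 2 ^ k
  | .gg P P' => 1 ≤ P ∧ P < P' ∧ P' < 2 ^ k
  | .dd Q Q' => 1 ≤ Q ∧ Q < Q' ∧ Q' < 2 ^ k

/-- The vertex NUMBERS (`c = v.val + 1`) of a descriptor: `γ_P ↦ P`, `ω ↦ 2^k`, `δ_Q ↦ 2^k + Q`. -/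
def Col.verts (k : ℕ) : Col → Finset ℕ
  | .empty => ∅
  | .om => {2 ^ k}
  | .gam P => {P}
  | .del Q => {2 ^ k + Q}
  | .omGam P => {P, 2 ^ k}
  | .omDel Q => {2 ^ k, 2 ^ k + Q}
  | .cross P Q => {P, 2 ^ k + Q}
  | .gg P P' => {P, P'}
  | .dd Q Q' => {2 ^ k + Q, 2 ^ k + Q'}

/-- The column finset of a descriptor: the vertices `v` whose number `v.val + 1` is listed. -/
def colOf (k : ℕ) (d : Col) : Finset (Fin h) := univ.filter fun v => v.val + 1 ∈ d.verts k

/-- Membership in `colOf`. -/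
theorem mem_colOf {k : ℕ} {d : Col} {v : Fin h} : v ∈ colOf k d ↔ v.val + 1 ∈ d.verts k := by
  simp [colOf]

/-- The key radix `R = 4·2^k` (exceeds every key component: indices `≤ 2^k`, `2·popcount + 1 ≤ 2k + 1`, sides `≤ 1`). -/
def radix (k : ℕ) : ℕ := 4 * 2 ^ k

/-- **The elimination key, as a 4-tuple** (memo §14/§15, simplified): `∅ (0,…) < ω (1,…) < ω-edges (2, side, index, 0) < vertices (3, side, index, 0)
< crosses (4, P, Q, 0) < E-columns: γ_Pγ_P' ↦ (5, P, 2|P'|+1, P'), δ_Qδ_Q' ↦ (5, Q, 2|Q'−1|, Q')` (lexicographic). -/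
def Col.tup : Col → ℕ × ℕ × ℕ × ℕ
  | .empty => (0, 0, 0, 0)
  | .om => (1, 0, 0, 0)
  | .omGam P => (2, 0, P, 0)
  | .omDel Q => (2, 1, Q, 0)
  | .gam P => (3, 0, P, 0)
  | .del Q => (3, 1, Q, 0)
  | .cross P Q => (4, P, Q, 0)
  | .gg P P' => (5, P, 2 * (bits P').card + 1, P')
  | .dd Q Q' => (5, Q, 2 * (bits (Q' - 1)).card, Q')

/-- **The elimination key** of a column: its 4-tuple packed into one natural number by `tk` with radix `4·2^k`. -/
def Col.key (k : ℕ) (d : Col) : ℕ := tk (radix k) d.tup.1 d.tup.2.1 d.tup.2.2.1 d.tup.2.2.2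

/-- **The designated triple** `(S, e, T)` of a column (memo §15): `∅→(∅,0,∅)`, `ω→(∅,1,∅)`, `γ_P→(P,0,∅)`, `δ_Q→(∅,0,Q)`, `ωγ_P→(P,1,∅)`, `ωδ_Q→(∅,1,Q)`,
`γ_Pδ_Q→(P,0,Q)`, `γ_Pγ_P'→(P,1,P')`, `δ_Qδ_Q'→(Q'−1,1,Q)` (index sets = `bits` of the numbers). -/
def Col.dtrip : Col → Finset ℕ × Bool × Finset ℕ
  | .empty => (∅, false, ∅)
  | .om => (∅, true, ∅)
  | .gam P => (bits P, false, ∅)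
  | .del Q => (∅, false, bits Q)
  | .omGam P => (bits P, true, ∅)
  | .omDel Q => (∅, true, bits Q)
  | .cross P Q => (bits P, false, bits Q)
  | .gg P P' => (bits P, true, bits P')
  | .dd Q Q' => (bits (Q' - 1), true, bits Q)

/-- The designated ROW of a column. -/
def dRow (k : ℕ) (d : Col) : Finset (Fin h) := rowOf k d.dtrip.1 d.dtrip.2.1 d.dtrip.2.2

/-- **The owner map** (inverse of the designated triple on rows; memo §15): `(S,0,T) ↦ ∅ / γ_S / δ_T / γ_Sδ_T`; `(S,1,∅) ↦ ω / ωγ_S`; `(∅,1,T) ↦ ωδ_T`;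
`(S,1,T)` (`S, T ≠ ∅`) `↦ γ_Sγ_T` if `S < T`, `δ_Tδ_{S+1}` if `T ≤ S` (as binary numbers). -/
def own (S : Finset ℕ) (e : Bool) (T : Finset ℕ) : Col :=
  if e = true then
    (if T = ∅ then (if S = ∅ then .om else .omGam (enc S))
     else if S = ∅ then .omDel (enc T)
     else if enc S < enc T then .gg (enc S) (enc T) else .dd (enc T) (enc S + 1))
  else
    (if S = ∅ then (if T = ∅ then .empty else .del (enc T))
     else if T = ∅ then .gam (enc S) else .cross (enc S) (enc T))

end DecFamily

end Summit.ValiantsHypothesis.ValiantsHypothesis.Theorems.BarrierLever.AnchoredPeeling
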